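import Literature.AlgebraicGeometry.Motives.AbelianVarietyEndGaloisFinite
import Literature.AlgebraicGeometry.Motives.AbelianVarietyHomComplexGaloisDescent
import HarnessLib

/-!
# Galois conjugates of homomorphisms `P_L → Q_L` act on `L`-points by conjugation

Topic `Literature/AlgebraicGeometry/Motives`, namespace `Literature.AlgebraicGeometry.Motives.AbelianVariety`.
THEOREMS ONLY (no definition, no named fact, no instance; net Literature debt 0).

The HOM twin of the tree's `AbelianVariety.pointsEnd_galConj` (`AbelianVarietyEndGaloisFinite` §1, endomorphisms
of `P_L`), with the SAME conventions: for abelian varieties `P`, `Q` over `K`, a field extension `L/K`,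
`σ ∈ Aut(L/K)`, and a homomorphism `r : P ⊗_K L → Q ⊗_K L`, the Galois conjugate
`σ • r = galConjHom L σ P Q r` (`gal σ⁻¹ ≫ r ≫ gal σ`, ★ `JacobianGaloisDescent` / `AbelianVarietyHomComplexGaloisDescent`)
acts on the `L`-points `P(L) → Q(L)` — read through `P(L) ≃ P_L(L)`, `Q(L) ≃ Q_L(L)` (`pointsMulEquiv`) — by
**`(σ • r)(σ • x) = σ • r(x)`**, equivalently `(σ • r)(x) = σ • r(σ⁻¹ • x)` ([Milne2005ShimuraVarieties] §13,
proof of Prop. 13.1: «`f` commutes with the actions of `Aut(Ω/k)` iff `σf = f`»; [GortzWedhorn2020] (14.20)).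
Consequently `σ • r = r` as soon as `r` commutes with `σ` on `L`-points of the form appearing in a separating
family (used with torsion points in `Literature.NumberTheory.ComplexMultiplication.HeckeCharacterIsogenyRational`,
[Shimura1998] Lemma 19.12).

* `pointsMulEquiv_symm_comp_left` — the `L`-point `r(x) := pointsMulEquiv⁻¹ (x_L ≫ r)` of `Q` on schemes:
  `x_L ≫ r ≫ pr`.
* `pointsMulEquiv_symm_comp_galConjHom_smul` — **`(σ • r)(σ • x) = σ • r(x)`**;
  `pointsMulEquiv_symm_comp_galConjHom` — **`(σ • r)(x) = σ • r(σ⁻¹ • x)`**;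
  `pointsMulEquiv_symm_comp_smul_of_galConjHom_eq` — a Galois-fixed `r` commutes with `σ` on `L`-points;
  `pointsEquiv_symm_map_galConjHom_smul`, `pointsEquiv_symm_map_smul_of_galConjHom_eq` — the same in the
  `AlgPoints.map` / `pointsEquiv` spelling of the CM files.

## References
* [Milne2005ShimuraVarieties] J. S. Milne, *Introduction to Shimura Varieties* (2005/2017), §13, Prop. 13.1 and
  its proof (p. 117).
* [GortzWedhorn2020] U. Görtz, T. Wedhorn, *Algebraic Geometry I* (2nd ed.), §(14.20) (Galois descent).
* [Shimura1998] G. Shimura, *Abelian Varieties with Complex Multiplication and Modular Functions* (1998), §19.12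
  proof of Lemma 19.12 (p. 138): `λ^σ(r(v)^σ) = (λ r(v))^σ`.
-/

noncomputable section

universe u

open CategoryTheory CategoryTheory.Limits AlgebraicGeometry

namespace Literature.AlgebraicGeometry.Motives

namespace AbelianVariety

set_option backward.isDefEq.respectTransparency false

variable {K : Type u} [Field K] (L : Type u) [Field L] [Algebra K L] (σ : L ≃ₐ[K] L)
  (P Q : AbelianVariety K)

/-- The `L`-point `r(x) = pointsMulEquiv⁻¹ (x_L ≫ r) ∈ Q(L)` of a homomorphism `r : P_L → Q_L` at `x ∈ P(L)`, on
underlying schemes: `x_L ≫ r ≫ pr` (`pr : Q_L → Q` the projection). [cite: GortzWedhorn2020, §(14.20) and §(4.7)] -/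
theorem pointsMulEquiv_symm_comp_left (r : P.baseChange L ⟶ Q.baseChange L) (x : P.Points L) :
    ((Q.pointsMulEquiv L).symm (P.pointsMulEquiv L x ≫ r.hom.hom.hom)).left =
      (P.pointsEquiv L x).left ≫ Hom.toSchemeHom r ≫ pullback.fst Q.X.hom (bcSpec K L) := by
  change ((Q.pointsEquiv L).symm (P.pointsEquiv L x ≫ r.hom.hom.hom)).left = _
  rw [pointsEquiv_symm_apply_left, Over.comp_left, Category.assoc]

/-- **`(σ • r)(σ • x) = σ • r(x)`**: the Galois conjugate `σ • r = gal σ⁻¹ ≫ r ≫ gal σ` of a homomorphism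
`r : P_L → Q_L` acts on `L`-points by conjugation (on schemes `(σ • x)_L = Spec σ ≫ x_L ≫ gal σ`,
`pointsEquiv_smul_left`, and `gal σ ≫ gal σ⁻¹ = 1`, `gal σ ≫ pr = pr`).
[cite: Milne2005ShimuraVarieties, §13 Prop. 13.1 and proof, p. 117] [cite: GortzWedhorn2020, §(14.20)] -/
theorem pointsMulEquiv_symm_comp_galConjHom_smul (r : P.baseChange L ⟶ Q.baseChange L) (x : P.Points L) :
    (Q.pointsMulEquiv L).symm (P.pointsMulEquiv L (σ • x) ≫ (galConjHom L σ P Q r).hom.hom.hom) =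
      σ • (Q.pointsMulEquiv L).symm (P.pointsMulEquiv L x ≫ r.hom.hom.hom) := by
  apply Over.OverMorphism.ext
  have h1 : ((Q.pointsMulEquiv L).symm (P.pointsMulEquiv L (σ • x) ≫ (galConjHom L σ P Q r).hom.hom.hom)).left =
      specAut L σ ≫ (P.pointsEquiv L x).left ≫ Hom.toSchemeHom r ≫ pullback.fst Q.X.hom (bcSpec K L) := by
    rw [pointsMulEquiv_symm_comp_left, toSchemeHom_galConjHom, pointsEquiv_smul_left]
    simp only [Category.assoc, gal_fst, gal_comp_gal_symm_assoc]
  have h2 : (σ • (Q.pointsMulEquiv L).symm (P.pointsMulEquiv L x ≫ r.hom.hom.hom)).left =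
      specAut L σ ≫ (P.pointsEquiv L x).left ≫ Hom.toSchemeHom r ≫ pullback.fst Q.X.hom (bcSpec K L) := by
    rw [AlgPoints.smul_left, pointsMulEquiv_symm_comp_left]
  rw [h1, h2]

/-- **`(σ • r)(x) = σ • r(σ⁻¹ • x)`** — the Hom form of `pointsEnd_galConj`.
[cite: Milne2005ShimuraVarieties, §13 Prop. 13.1 and proof, p. 117] -/
theorem pointsMulEquiv_symm_comp_galConjHom (r : P.baseChange L ⟶ Q.baseChange L) (x : P.Points L) :
    (Q.pointsMulEquiv L).symm (P.pointsMulEquiv L x ≫ (galConjHom L σ P Q r).hom.hom.hom) =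
      σ • (Q.pointsMulEquiv L).symm (P.pointsMulEquiv L (σ⁻¹ • x) ≫ r.hom.hom.hom) := by
  have h := pointsMulEquiv_symm_comp_galConjHom_smul L σ P Q r (σ⁻¹ • x)
  rwa [smul_inv_smul] at h

/-- **A Galois-fixed homomorphism commutes with `σ` on `L`-points**: if `σ • r = r` then
`r(σ • x) = σ • r(x)` for `x ∈ P(L)` («⇒» of [Milne2005ShimuraVarieties] Prop. 13.1's equivariance).
[cite: Milne2005ShimuraVarieties, §13 Prop. 13.1 and proof, p. 117] -/
theorem pointsMulEquiv_symm_comp_smul_of_galConjHom_eq (r : P.baseChange L ⟶ Q.baseChange L)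
    (hr : galConjHom L σ P Q r = r) (x : P.Points L) :
    (Q.pointsMulEquiv L).symm (P.pointsMulEquiv L (σ • x) ≫ r.hom.hom.hom) =
      σ • (Q.pointsMulEquiv L).symm (P.pointsMulEquiv L x ≫ r.hom.hom.hom) := by
  have h := pointsMulEquiv_symm_comp_galConjHom_smul L σ P Q r x
  rwa [hr] at h

/-- **`(σ • r)(σ • x) = σ • r(x)`** in the `AlgPoints.map` / `pointsEquiv` spelling of the CM files
(`AlgPoints.map φ P = P ≫ φ`, `pointsMulEquiv = pointsEquiv` on elements).
[cite: Milne2005ShimuraVarieties, §13 Prop. 13.1 and proof, p. 117] -/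
theorem pointsEquiv_symm_map_galConjHom_smul (r : P.baseChange L ⟶ Q.baseChange L) (x : P.Points L) :
    (Q.pointsEquiv L).symm (AlgPoints.map (galConjHom L σ P Q r).hom.hom.hom (P.pointsEquiv L (σ • x))) =
      σ • (Q.pointsEquiv L).symm (AlgPoints.map r.hom.hom.hom (P.pointsEquiv L x)) :=
  pointsMulEquiv_symm_comp_galConjHom_smul L σ P Q r x

/-- A Galois-fixed `r` commutes with `σ` on `L`-points, `AlgPoints.map` / `pointsEquiv` spelling.
[cite: Milne2005ShimuraVarieties, §13 Prop. 13.1 and proof, p. 117] -/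
theorem pointsEquiv_symm_map_smul_of_galConjHom_eq (r : P.baseChange L ⟶ Q.baseChange L)
    (hr : galConjHom L σ P Q r = r) (x : P.Points L) :
    (Q.pointsEquiv L).symm (AlgPoints.map r.hom.hom.hom (P.pointsEquiv L (σ • x))) =
      σ • (Q.pointsEquiv L).symm (AlgPoints.map r.hom.hom.hom (P.pointsEquiv L x)) :=
  pointsMulEquiv_symm_comp_smul_of_galConjHom_eq L σ P Q r hr x

end AbelianVariety

end Literature.AlgebraicGeometry.Motives

end
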